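import Mathlib
import Summits.NavierStokesRegularity.NavierStokesRegularity.Theorems.EulerZoomLiouvillePowerGaugeEulerLiouvilleShellLawTools
import Summits.NavierStokesRegularity.NavierStokesRegularity.Theorems.EulerZoomLiouvillePowerGaugeEulerLiouvilleTransportGradientTest

/-!
# R50 plates t53-TS / t53-TD: the TRANSPORT SHELL LAW (every real `α`) and its DIFFERENTIAL FORM
# (nsreg-p2 ROUND-50 «THE WALL COMES FOR FREE» §4, `NsregP2.R50.TransportShellLaw γ α` / `TransportShellLawDeriv γ α`, texts VERBATIM
# from `r50/Sketch50.lean` 6c31f8f6e879902e with `selfSimilarTransport` / `modPressure` UNFOLDED; seat ns-ezl-w2 g6,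
# `--supports stmt-NavierStokesRegularity-19832 --as helper`)

Chae–Wolf's `‖x − x₀‖^{−α}` family (arXiv:1506.04361, Remark 2.3 (2.8), "for all `0 < r < R` and `α ∈ ℝ`") in transport variables
`W = γ(y−c)+V`, `Π = P − ½γ(1−γ)‖y−c‖²`, about EVERY centre `x₀`:
`r₂^{3−α}·S(r₂) − r₁^{3−α}·S(r₁) = ∫_{B_{r₂}(x₀)∖B_{r₁}(x₀)} ‖z‖^{−α}(‖W‖² − αW_n² + (3−α)Π + γ(5γ−1)‖z‖²) dy`, `S = sphereIntegral(W_n² + Π)`,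
and `d/dr[r^{3−α}S(r)] = r^{2−α}·sphereIntegral(‖W‖² − αW_n² + (3−α)Π)(r) + 4πγ(5γ−1)r^{4−α}`.
Proof («Π̂-trick» + the α-family engine): `shellLaw_of_meanValue` / `hasDerivAt_rpow_mul_sphereIntegral_of_meanValue` (`…ShellLawTools`)
for the pair `(W, Π̂_{x₀})`, `Π̂_{x₀} = Π − ½γ(5γ−1)‖y−x₀‖²` (tent mean-value formula from `transportRadialVirialIdentity` via ns-sfl-p1 g8's
`meanValueFormula_of_radialVirial`), then the shift `Π = Π̂ + ½γ(5γ−1)‖z‖²` on spheres (`+ 2πγ(5γ−1)r²`) and on the shell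
(`½γ(5γ−1)(5−α)∫_{shell}‖z‖^{2−α} = 2πγ(5γ−1)(r₂^{5−α} − r₁^{5−α})`, FTC for `t^{5−α}` — uniform in `α`, incl. `α = 5`).

HONEST FRAMING: ROUND-50 instrument identities (class-free); nothing about the crux E (19832 OPEN) or NS regularity.
[cite: ChaeWolf2016, Remark 2.3 (2.8)] [folklore]
-/

noncomputable section

set_option linter.dupNamespace false

open MeasureTheory Set Filter Topology Metric Function TopologicalSpace
open scoped ENNReal NNReal RealInnerProductSpace Topology

namespace Summit.NavierStokesRegularity.NavierStokesRegularity.Theorems.PowerGaugeEulerLiouville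

open Literature.Analysis Literature.Analysis.FunctionSpaces Literature.Analysis.FluidPDE

namespace ClassicalProfile

/-! ## Shifting the scalar by `κ‖z‖²` on spheres -/

section Shift

variable {U : EuclideanSpace ℝ (Fin 3) → EuclideanSpace ℝ (Fin 3)} {Q : EuclideanSpace ℝ (Fin 3) → ℝ}

/-- **Sphere with a radial summand**: `sphereIntegral volume (z ↦ f z + g ‖z‖) r = sphereIntegral volume f r + 4π·g r` (`r ≥ 0`), for
`f` integrable on the sphere of radius `r`. [folklore] -/
theorem sphereIntegral_add_radial (f : EuclideanSpace ℝ (Fin 3) → ℝ) (g : ℝ → ℝ) {r : ℝ} (hr : 0 ≤ r)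
    (hf : Integrable (fun θ : sphere (0 : EuclideanSpace ℝ (Fin 3)) 1 => f (r • (θ : EuclideanSpace ℝ (Fin 3))))
      (volume : Measure (EuclideanSpace ℝ (Fin 3))).toSphere) :
    sphereIntegral volume (fun z : EuclideanSpace ℝ (Fin 3) => f z + g ‖z‖) r = sphereIntegral volume f r + 4 * Real.pi * g r := by
  have hg : Integrable (fun θ : sphere (0 : EuclideanSpace ℝ (Fin 3)) 1 => g ‖r • (θ : EuclideanSpace ℝ (Fin 3))‖)
      (volume : Measure (EuclideanSpace ℝ (Fin 3))).toSphere := by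
    have h : (fun θ : sphere (0 : EuclideanSpace ℝ (Fin 3)) 1 => g ‖r • (θ : EuclideanSpace ℝ (Fin 3))‖) = fun _ => g r := by
      funext θ; rw [norm_smul_sphere hr θ]
    rw [h]
    exact integrable_const _
  rw [← sphereIntegral_radial_fun g hr, sphereIntegral_def, sphereIntegral_def, sphereIntegral_def, ← integral_add hf hg]

/-- On the sphere of radius `r > 0` the normal-energy integrand `⟪U(rθ+x₀), rθ⟫²/‖rθ‖² + Q(rθ+x₀)` is continuous in `θ`
(`U`, `Q` continuous). [folklore] -/
theorem continuous_sphere_normalSq_add (hU : Continuous U) (hQ : Continuous Q) (x₀ : EuclideanSpace ℝ (Fin 3)) {r : ℝ} (hr : 0 < r) :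
    Continuous fun θ : sphere (0 : EuclideanSpace ℝ (Fin 3)) 1 =>
      ⟪U (r • (θ : EuclideanSpace ℝ (Fin 3)) + x₀), r • (θ : EuclideanSpace ℝ (Fin 3))⟫ ^ 2 / ‖r • (θ : EuclideanSpace ℝ (Fin 3))‖ ^ 2
        + Q (r • (θ : EuclideanSpace ℝ (Fin 3)) + x₀) := by
  have h0 : Continuous fun θ : sphere (0 : EuclideanSpace ℝ (Fin 3)) 1 => r • (θ : EuclideanSpace ℝ (Fin 3)) := by fun_prop
  refine (((hU.comp (h0.add continuous_const)).inner h0).pow 2).div (h0.norm.pow 2) (fun θ => ?_) |>.add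
    (hQ.comp (h0.add continuous_const))
  have hθ : ‖r • (θ : EuclideanSpace ℝ (Fin 3))‖ = r := norm_smul_sphere hr.le θ
  simp only [Pi.pow_apply, hθ]
  positivity

/-- **Shift on spheres, normal form**: `sphereIntegral(U_n² + Q)(r) = sphereIntegral(U_n² + (Q − κ‖z‖²))(r) + 4πκr²` (`r > 0`). [folklore] -/
theorem sphereIntegral_normalSq_add_shift (hU : Continuous U) (hQ : Continuous Q) (x₀ : EuclideanSpace ℝ (Fin 3)) (κ : ℝ) {r : ℝ}
    (hr : 0 < r) :
    sphereIntegral volume (fun z : EuclideanSpace ℝ (Fin 3) => ⟪U (z + x₀), z⟫ ^ 2 / ‖z‖ ^ 2 + Q (z + x₀)) r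
      = sphereIntegral volume (fun z : EuclideanSpace ℝ (Fin 3) => ⟪U (z + x₀), z⟫ ^ 2 / ‖z‖ ^ 2 + (Q (z + x₀) - κ * ‖z‖ ^ 2)) r
        + 4 * Real.pi * κ * r ^ 2 := by
  have hQ' : Continuous fun y : EuclideanSpace ℝ (Fin 3) => Q y - κ * ‖y - x₀‖ ^ 2 := by fun_prop
  have e : (fun z : EuclideanSpace ℝ (Fin 3) => ⟪U (z + x₀), z⟫ ^ 2 / ‖z‖ ^ 2 + Q (z + x₀)) =
      fun z => (⟪U (z + x₀), z⟫ ^ 2 / ‖z‖ ^ 2 + (Q (z + x₀) - κ * ‖z‖ ^ 2)) + (fun s : ℝ => κ * s ^ 2) ‖z‖ := by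
    funext z; ring
  have hint := integrable_sphere_of_continuous (continuous_sphere_normalSq_add hU hQ' x₀ hr)
  simp only [add_sub_cancel_right] at hint
  rw [e, sphereIntegral_add_radial _ (fun s : ℝ => κ * s ^ 2) hr.le hint]
  ring

/-- **Shift on spheres, energy form**: `sphereIntegral(‖U‖² + 3Q)(r) = sphereIntegral(‖U‖² + 3(Q − κ‖z‖²))(r) + 12πκr²` (`r ≥ 0`). [folklore] -/
theorem sphereIntegral_energy_shift (hU : Continuous U) (hQ : Continuous Q) (x₀ : EuclideanSpace ℝ (Fin 3)) (κ : ℝ) {r : ℝ}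
    (hr : 0 ≤ r) :
    sphereIntegral volume (fun z : EuclideanSpace ℝ (Fin 3) => ‖U (z + x₀)‖ ^ 2 + 3 * Q (z + x₀)) r
      = sphereIntegral volume (fun z : EuclideanSpace ℝ (Fin 3) => ‖U (z + x₀)‖ ^ 2 + 3 * (Q (z + x₀) - κ * ‖z‖ ^ 2)) r
        + 12 * Real.pi * κ * r ^ 2 := by
  have e : (fun z : EuclideanSpace ℝ (Fin 3) => ‖U (z + x₀)‖ ^ 2 + 3 * Q (z + x₀)) =
      fun z => (‖U (z + x₀)‖ ^ 2 + 3 * (Q (z + x₀) - κ * ‖z‖ ^ 2)) + (fun s : ℝ => 3 * κ * s ^ 2) ‖z‖ := by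
    funext z; ring
  have hint : Integrable (fun θ : sphere (0 : EuclideanSpace ℝ (Fin 3)) 1 =>
      ‖U (r • (θ : EuclideanSpace ℝ (Fin 3)) + x₀)‖ ^ 2 + 3 * (Q (r • (θ : EuclideanSpace ℝ (Fin 3)) + x₀)
        - κ * ‖r • (θ : EuclideanSpace ℝ (Fin 3))‖ ^ 2)) (volume : Measure (EuclideanSpace ℝ (Fin 3))).toSphere :=
    integrable_sphere_of_continuous (by fun_prop)
  rw [e, sphereIntegral_add_radial _ (fun s : ℝ => 3 * κ * s ^ 2) hr hint]
  ring

/-- **Shift on spheres, shell-integrand form**: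
`sphereIntegral(‖U‖² − αU_n² + (3−α)Q)(r) = sphereIntegral(‖U‖² − αU_n² + (3−α)(Q − κ‖z‖²))(r) + (3−α)·4πκr²` (`r > 0`). [folklore] -/
theorem sphereIntegral_shellIntegrand_shift (hU : Continuous U) (hQ : Continuous Q) (x₀ : EuclideanSpace ℝ (Fin 3)) (κ α : ℝ)
    {r : ℝ} (hr : 0 < r) :
    sphereIntegral volume (fun z : EuclideanSpace ℝ (Fin 3) =>
        ‖U (z + x₀)‖ ^ 2 - α * (⟪U (z + x₀), z⟫ ^ 2 / ‖z‖ ^ 2) + (3 - α) * Q (z + x₀)) r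
      = sphereIntegral volume (fun z : EuclideanSpace ℝ (Fin 3) =>
        ‖U (z + x₀)‖ ^ 2 - α * (⟪U (z + x₀), z⟫ ^ 2 / ‖z‖ ^ 2) + (3 - α) * (Q (z + x₀) - κ * ‖z‖ ^ 2)) r
        + (3 - α) * (4 * Real.pi * κ * r ^ 2) := by
  have hQ' : Continuous fun y : EuclideanSpace ℝ (Fin 3) => Q y - κ * ‖y - x₀‖ ^ 2 := by fun_prop
  have h1 := sphereIntegral_shellIntegrand_eq hU hQ x₀ α hr
  have h2 := sphereIntegral_shellIntegrand_eq hU hQ' x₀ α hr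
  simp only [add_sub_cancel_right] at h2
  have h3 := sphereIntegral_energy_shift hU hQ x₀ κ hr.le
  have h4 := sphereIntegral_normalSq_add_shift hU hQ x₀ κ hr
  rw [sphereIntegral_normalSq_eq x₀ hr] at h4
  have h5 := sphereIntegral_normalSq_eq (V := U) (P := fun y => Q y - κ * ‖y - x₀‖ ^ 2) x₀ hr
  simp only [add_sub_cancel_right] at h5
  rw [h5] at h4
  rw [h1, h2, h3, h4]
  ring

end Shift

/-! ## The transport shell law and its differential form -/

/-- **TRANSPORT SHELL LAW, every real `α`, every centre** (`NsregP2.R50.TransportShellLaw γ α`, text verbatim with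
`selfSimilarTransport`/`modPressure` unfolded): see the module docstring. [cite: ChaeWolf2016, Remark 2.3 (2.8)] [folklore] -/
theorem transportShellLaw (γ α : ℝ) :
    ∀ (c : EuclideanSpace ℝ (Fin 3)) (V : EuclideanSpace ℝ (Fin 3) → EuclideanSpace ℝ (Fin 3)) (P : EuclideanSpace ℝ (Fin 3) → ℝ),
      IsSelfSimilarEulerProfile γ c V P →
      ∀ (x₀ : EuclideanSpace ℝ (Fin 3)) (r₁ r₂ : ℝ), 0 < r₁ → r₁ < r₂ →
        r₂ ^ (3 - α) * sphereIntegral volume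
              (fun z : EuclideanSpace ℝ (Fin 3) => ⟪γ • (z + x₀ - c) + V (z + x₀), z⟫ ^ 2 / ‖z‖ ^ 2
                + (P (z + x₀) - γ * (1 - γ) / 2 * ‖z + x₀ - c‖ ^ 2)) r₂
          - r₁ ^ (3 - α) * sphereIntegral volume
              (fun z : EuclideanSpace ℝ (Fin 3) => ⟪γ • (z + x₀ - c) + V (z + x₀), z⟫ ^ 2 / ‖z‖ ^ 2
                + (P (z + x₀) - γ * (1 - γ) / 2 * ‖z + x₀ - c‖ ^ 2)) r₁
        = ∫ y in ball x₀ r₂ \ ball x₀ r₁,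
            ‖y - x₀‖ ^ (-α) * (‖γ • (y - c) + V y‖ ^ 2 - α * (⟪γ • (y - c) + V y, y - x₀⟫ ^ 2 / ‖y - x₀‖ ^ 2)
                + (3 - α) * (P y - γ * (1 - γ) / 2 * ‖y - c‖ ^ 2) + γ * (5 * γ - 1) * ‖y - x₀‖ ^ 2) := by
  intro c V P hprof x₀ r₁ r₂ hr₁ h12
  have hr₂ : 0 < r₂ := hr₁.trans h12
  have hV : Continuous V := hprof.contDiff_velocity.continuous
  have hP : Continuous P := hprof.contDiff_pressure.continuous
  have hWc : Continuous fun y : EuclideanSpace ℝ (Fin 3) => γ • (y - c) + V y := by fun_prop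
  have hPmc : Continuous fun y : EuclideanSpace ℝ (Fin 3) => P y - γ * (1 - γ) / 2 * ‖y - c‖ ^ 2 := by fun_prop
  have hPhc : Continuous fun y : EuclideanSpace ℝ (Fin 3) =>
      P y - γ * (1 - γ) / 2 * ‖y - c‖ ^ 2 - γ * (5 * γ - 1) / 2 * ‖y - x₀‖ ^ 2 := by fun_prop
  -- the tent mean-value formula for `(W, Π̂)` at every radius, and the engine
  have hMV : ∀ ρ : ℝ, 0 < ρ →
      ∫ y in ball x₀ ρ, (⟪γ • (y - c) + V y, y - x₀⟫ ^ 2 / ‖y - x₀‖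
          + ‖y - x₀‖ * (P y - γ * (1 - γ) / 2 * ‖y - c‖ ^ 2 - γ * (5 * γ - 1) / 2 * ‖y - x₀‖ ^ 2))
        = ∫ y in ball x₀ ρ, (ρ - ‖y - x₀‖) * (‖γ • (y - c) + V y‖ ^ 2
          + 3 * (P y - γ * (1 - γ) / 2 * ‖y - c‖ ^ 2 - γ * (5 * γ - 1) / 2 * ‖y - x₀‖ ^ 2)) := fun ρ hρ =>
    meanValueFormula_of_radialVirial hWc hPhc x₀ (fun ψ h1 h2 => transportRadialVirialIdentity γ c V P hprof x₀ ψ h1 h2) hρ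
  have h := shellLaw_of_meanValue hWc hPhc x₀ hMV α hr₁ h12
  simp only [add_sub_cancel_right] at h
  -- shifts on the two spheres
  have hs₁ := sphereIntegral_normalSq_add_shift hWc hPmc x₀ (γ * (5 * γ - 1) / 2) hr₁
  have hs₂ := sphereIntegral_normalSq_add_shift hWc hPmc x₀ (γ * (5 * γ - 1) / 2) hr₂
  -- the radial shell moment `(5−α)∫_{shell}‖z‖^{−α}‖z‖² = 4π(r₂^{5−α} − r₁^{5−α})`
  have hK : IsCompact (closedBall x₀ r₂ \ ball x₀ r₁) := (isCompact_closedBall x₀ r₂).diff isOpen_ball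
  have hIrad : IntegrableOn (fun y : EuclideanSpace ℝ (Fin 3) => ‖y - x₀‖ ^ (-α) * ‖y - x₀‖ ^ 2) (ball x₀ r₂ \ ball x₀ r₁) := by
    refine (ContinuousOn.integrableOn_compact hK ?_).mono_set fun y hy => ⟨ball_subset_closedBall hy.1, hy.2⟩
    intro y hy
    have hn : ‖y - x₀‖ ≠ 0 := by
      intro h0
      have : y ∈ ball x₀ r₁ := by rw [mem_ball, dist_eq_norm, h0]; exact hr₁
      exact hy.2 this
    exact ((((continuous_id.sub continuous_const).norm.continuousAt).rpow_const (Or.inl hn)).mul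
      (((continuous_id.sub continuous_const).norm.pow 2).continuousAt)).continuousWithinAt
  have hpos : ∀ t ∈ uIcc r₁ r₂, 0 < t := by
    intro t ht
    rw [uIcc_of_le h12.le] at ht
    exact hr₁.trans_le ht.1
  have hM : (5 - α) * ∫ y in ball x₀ r₂ \ ball x₀ r₁, ‖y - x₀‖ ^ (-α) * ‖y - x₀‖ ^ 2
      = 4 * Real.pi * (r₂ ^ (5 - α) - r₁ ^ (5 - α)) := by
    rw [setIntegral_shell_eq_intervalIntegral_sphereIntegral hIrad hr₁ h12.le]
    have hrad : ∀ t ∈ uIcc r₁ r₂, t ^ 2 * sphereIntegral volume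
        (fun z : EuclideanSpace ℝ (Fin 3) => ‖z + x₀ - x₀‖ ^ (-α) * ‖z + x₀ - x₀‖ ^ 2) t = 4 * Real.pi * t ^ (4 - α) := by
      intro t ht
      have ht0 := hpos t ht
      simp only [add_sub_cancel_right]
      rw [sphereIntegral_radial_fun (fun s : ℝ => s ^ (-α) * s ^ 2) ht0.le]
      have e : t ^ 2 * (t ^ (-α) * t ^ 2) = t ^ (4 - α) := by
        rw [← Real.rpow_natCast t 2, ← Real.rpow_add ht0, ← Real.rpow_add ht0]; norm_num; ring_nf
      rw [show t ^ 2 * (4 * Real.pi * (t ^ (-α) * t ^ 2)) = 4 * Real.pi * (t ^ 2 * (t ^ (-α) * t ^ 2)) by ring, e]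
    rw [intervalIntegral.integral_congr hrad, intervalIntegral.integral_const_mul]
    have hderiv : ∀ t ∈ uIcc r₁ r₂, HasDerivAt (fun t : ℝ => t ^ (5 - α)) ((5 - α) * t ^ (4 - α)) t := by
      intro t ht
      have hd := Real.hasDerivAt_rpow_const (p := 5 - α) (Or.inl (hpos t ht).ne')
      rwa [show (5 : ℝ) - α - 1 = 4 - α by ring] at hd
    have hcont : ContinuousOn (fun t : ℝ => (5 - α) * t ^ (4 - α)) (uIcc r₁ r₂) :=
      continuousOn_const.mul (continuousOn_id.rpow_const fun t ht => Or.inl (hpos t ht).ne')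
    have hFTC := intervalIntegral.integral_eq_sub_of_hasDerivAt hderiv hcont.intervalIntegrable
    rw [intervalIntegral.integral_const_mul] at hFTC
    linear_combination 4 * Real.pi * hFTC
  -- split the target shell integral
  have hI := integrableOn_shell_rpow_integrand hWc hPhc x₀ α hr₁ r₂
  have hsplit : ∫ y in ball x₀ r₂ \ ball x₀ r₁,
      ‖y - x₀‖ ^ (-α) * (‖γ • (y - c) + V y‖ ^ 2 - α * (⟪γ • (y - c) + V y, y - x₀⟫ ^ 2 / ‖y - x₀‖ ^ 2)
        + (3 - α) * (P y - γ * (1 - γ) / 2 * ‖y - c‖ ^ 2) + γ * (5 * γ - 1) * ‖y - x₀‖ ^ 2)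
      = (∫ y in ball x₀ r₂ \ ball x₀ r₁,
          ‖y - x₀‖ ^ (-α) * (‖γ • (y - c) + V y‖ ^ 2 - α * (⟪γ • (y - c) + V y, y - x₀⟫ ^ 2 / ‖y - x₀‖ ^ 2)
            + (3 - α) * (P y - γ * (1 - γ) / 2 * ‖y - c‖ ^ 2 - γ * (5 * γ - 1) / 2 * ‖y - x₀‖ ^ 2)))
        + (5 - α) * (γ * (5 * γ - 1) / 2) * ∫ y in ball x₀ r₂ \ ball x₀ r₁, ‖y - x₀‖ ^ (-α) * ‖y - x₀‖ ^ 2 := by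
    rw [← integral_const_mul, ← integral_add hI (hIrad.const_mul _)]
    refine integral_congr_ae (ae_of_all _ fun y => ?_)
    ring
  -- assemble
  have e1 : r₁ ^ (3 - α) * r₁ ^ 2 = r₁ ^ (5 - α) := by
    rw [← Real.rpow_natCast r₁ 2, ← Real.rpow_add hr₁]; norm_num; ring_nf
  have e2 : r₂ ^ (3 - α) * r₂ ^ 2 = r₂ ^ (5 - α) := by
    rw [← Real.rpow_natCast r₂ 2, ← Real.rpow_add hr₂]; norm_num; ring_nf
  rw [hs₁, hs₂, hsplit]
  linear_combination h + 4 * Real.pi * (γ * (5 * γ - 1) / 2) * e2 - 4 * Real.pi * (γ * (5 * γ - 1) / 2) * e1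
    - γ * (5 * γ - 1) / 2 * hM

/-- **TRANSPORT SHELL LAW, DIFFERENTIAL FORM** (`NsregP2.R50.TransportShellLawDeriv γ α`, text verbatim with
`selfSimilarTransport`/`modPressure` unfolded): for `r > 0`,
`d/dr[r^{3−α}·sphereIntegral(W_n² + Π)(r)] = r^{2−α}·sphereIntegral(‖W‖² − αW_n² + (3−α)Π)(r) + 4πγ(5γ−1)r^{4−α}`.
[cite: ChaeWolf2016, Remark 2.3 (2.8)] [folklore] -/
theorem transportShellLawDeriv (γ α : ℝ) :
    ∀ (c : EuclideanSpace ℝ (Fin 3)) (V : EuclideanSpace ℝ (Fin 3) → EuclideanSpace ℝ (Fin 3)) (P : EuclideanSpace ℝ (Fin 3) → ℝ),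
      IsSelfSimilarEulerProfile γ c V P →
      ∀ (x₀ : EuclideanSpace ℝ (Fin 3)) (r : ℝ), 0 < r →
        HasDerivAt
          (fun ϱ : ℝ => ϱ ^ (3 - α) * sphereIntegral volume
              (fun z : EuclideanSpace ℝ (Fin 3) => ⟪γ • (z + x₀ - c) + V (z + x₀), z⟫ ^ 2 / ‖z‖ ^ 2
                + (P (z + x₀) - γ * (1 - γ) / 2 * ‖z + x₀ - c‖ ^ 2)) ϱ)
          (r ^ (2 - α) * sphereIntegral volume
              (fun z : EuclideanSpace ℝ (Fin 3) => ‖γ • (z + x₀ - c) + V (z + x₀)‖ ^ 2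
                  - α * (⟪γ • (z + x₀ - c) + V (z + x₀), z⟫ ^ 2 / ‖z‖ ^ 2)
                  + (3 - α) * (P (z + x₀) - γ * (1 - γ) / 2 * ‖z + x₀ - c‖ ^ 2)) r
            + 4 * Real.pi * γ * (5 * γ - 1) * r ^ (4 - α))
          r := by
  intro c V P hprof x₀ r hr
  have hV : Continuous V := hprof.contDiff_velocity.continuous
  have hP : Continuous P := hprof.contDiff_pressure.continuous
  have hWc : Continuous fun y : EuclideanSpace ℝ (Fin 3) => γ • (y - c) + V y := by fun_prop
  have hPmc : Continuous fun y : EuclideanSpace ℝ (Fin 3) => P y - γ * (1 - γ) / 2 * ‖y - c‖ ^ 2 := by fun_prop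
  have hPhc : Continuous fun y : EuclideanSpace ℝ (Fin 3) =>
      P y - γ * (1 - γ) / 2 * ‖y - c‖ ^ 2 - γ * (5 * γ - 1) / 2 * ‖y - x₀‖ ^ 2 := by fun_prop
  have hMV : ∀ ρ : ℝ, 0 < ρ →
      ∫ y in ball x₀ ρ, (⟪γ • (y - c) + V y, y - x₀⟫ ^ 2 / ‖y - x₀‖
          + ‖y - x₀‖ * (P y - γ * (1 - γ) / 2 * ‖y - c‖ ^ 2 - γ * (5 * γ - 1) / 2 * ‖y - x₀‖ ^ 2))
        = ∫ y in ball x₀ ρ, (ρ - ‖y - x₀‖) * (‖γ • (y - c) + V y‖ ^ 2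
          + 3 * (P y - γ * (1 - γ) / 2 * ‖y - c‖ ^ 2 - γ * (5 * γ - 1) / 2 * ‖y - x₀‖ ^ 2)) := fun ρ hρ =>
    meanValueFormula_of_radialVirial hWc hPhc x₀ (fun ψ h1 h2 => transportRadialVirialIdentity γ c V P hprof x₀ ψ h1 h2) hρ
  have hD := hasDerivAt_rpow_mul_sphereIntegral_of_meanValue hWc hPhc x₀ hMV α hr
  simp only [add_sub_cancel_right] at hD
  -- the target function is the hat function plus `2πγ(5γ−1)ϱ^{5−α}` near `r`
  have heq : (fun ϱ : ℝ => ϱ ^ (3 - α) * sphereIntegral volume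
        (fun z : EuclideanSpace ℝ (Fin 3) => ⟪γ • (z + x₀ - c) + V (z + x₀), z⟫ ^ 2 / ‖z‖ ^ 2
          + (P (z + x₀) - γ * (1 - γ) / 2 * ‖z + x₀ - c‖ ^ 2 - γ * (5 * γ - 1) / 2 * ‖z‖ ^ 2)) ϱ
        + 4 * Real.pi * (γ * (5 * γ - 1) / 2) * ϱ ^ (5 - α))
      =ᶠ[𝓝 r] fun ϱ : ℝ => ϱ ^ (3 - α) * sphereIntegral volume
        (fun z : EuclideanSpace ℝ (Fin 3) => ⟪γ • (z + x₀ - c) + V (z + x₀), z⟫ ^ 2 / ‖z‖ ^ 2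
          + (P (z + x₀) - γ * (1 - γ) / 2 * ‖z + x₀ - c‖ ^ 2)) ϱ := by
    filter_upwards [Ioi_mem_nhds hr] with ϱ hϱ
    have hs := sphereIntegral_normalSq_add_shift hWc hPmc x₀ (γ * (5 * γ - 1) / 2) hϱ
    have e : ϱ ^ (3 - α) * ϱ ^ 2 = ϱ ^ (5 - α) := by
      rw [← Real.rpow_natCast ϱ 2, ← Real.rpow_add hϱ]; norm_num; ring_nf
    rw [hs, mul_add, ← e]
    ring
  have hpow : HasDerivAt (fun ϱ : ℝ => 4 * Real.pi * (γ * (5 * γ - 1) / 2) * ϱ ^ (5 - α))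
      (4 * Real.pi * (γ * (5 * γ - 1) / 2) * ((5 - α) * r ^ (4 - α))) r := by
    have hd := Real.hasDerivAt_rpow_const (p := 5 - α) (Or.inl hr.ne')
    rw [show (5 : ℝ) - α - 1 = 4 - α by ring] at hd
    exact hd.const_mul _
  refine ((hD.add hpow).congr_of_eventuallyEq heq.symm).congr_deriv ?_
  have hG := sphereIntegral_shellIntegrand_shift hWc hPmc x₀ (γ * (5 * γ - 1) / 2) α hr
  have e : r ^ (2 - α) * r ^ 2 = r ^ (4 - α) := by
    rw [← Real.rpow_natCast r 2, ← Real.rpow_add hr]; norm_num; ring_nf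
  rw [hG]
  linear_combination -((3 - α) * (4 * Real.pi * (γ * (5 * γ - 1) / 2))) * e

end ClassicalProfile

end Summit.NavierStokesRegularity.NavierStokesRegularity.Theorems.PowerGaugeEulerLiouville

end
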